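import Literature.AlgebraicGeometry.Resolution.CompleteLocalDomainJ0
import Literature.AlgebraicGeometry.Resolution.J2Criterion
import Literature.AlgebraicGeometry.Resolution.ExcellentRingsCompleteUC
import Literature.AlgebraicGeometry.Resolution.ExcellentRingsCompleteProofs
import HarnessLib

/-!
# Complete Noetherian local rings are excellent: discharge of `Stacks07QW_complete`

Topic: `Literature/AlgebraicGeometry/Resolution`. The named fact `Stacks07QW_complete` of
`ExcellentRings.lean` — The Stacks Project, Tag 07QW (2): Noetherian complete local rings are
excellent (Matsumura, *Commutative Ring Theory*, §32 p. 260: "A complete Noetherian local ring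
is excellent"; EGA IV₂ 7.8.3 (iii)) — is `IsUniversallyCatenaryRing A ∧ IsGRing A ∧ IsJ2Ring A`
for every complete Noetherian local ring `A`. Following the printed proof of 07QW ("See
Propositions 07PX and 07PJ to see that these rings are G-rings and have J-2. … Via the Cohen
structure theorem we see that complete local rings are universally catenary, see Algebra,
Remark 032C"), the three conjuncts are:

* universally catenary — `isUniversallyCatenaryRing_of_isAdicComplete`
  (`ExcellentRingsCompleteUC.lean`, Stacks 032C: Cohen–Macaulay/regular rings are universally
  catenary, `CatenaryRings.lean`, `CohenMacaulayUnmixed.lean`, `CohenMacaulayCatenary.lean`,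
  and Cohen's structure theorem in the form of Matsumura Thm. 29.4 (iii));
* G-ring — `Matsumura1987_32_3_holds` (`ExcellentRingsCompleteProofs.lean`, Matsumura Thm. 32.3
  = Stacks 07PX);
* J-2 — `isJ2Ring_of_isAdicComplete` below (Stacks 07PJ (2)), from Stacks 07PC
  (`J2Criterion.lean`) and Stacks 07PI (`CompleteLocalDomainJ0.lean`).

Everything is PROVED; this file closes the fact.

## Sources

* The Stacks Project, Tags 07QW, 07PJ, 07PC, 07PI, 032C, 07PX. [StacksProject]
* H. Matsumura, *Commutative Ring Theory*, CUP 1986, §32 p. 260 [PDF 278–279]; Thm. 29.4 (iii),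
  p. 225; Thm. 32.3, p. 257. [Matsumura1987]
-/

noncomputable section

open IsLocalRing

namespace Literature.AlgebraicGeometry.Resolution

universe u

section CompleteJ2

/-- **Stacks 07PJ (2): a Noetherian complete local ring is J-2.** Printed proof: "we will use
condition (3) [equivalently (4)] of Lemma 07PC … it suffices to prove that a Noetherian complete
local ring which is a domain is J-0, which is Lemma 07PI." Here condition (4) of 07PC
(`isJ2Ring_of_forall_exists_finite`) is verified as follows: for a prime `𝔭` and a finite
extension `l` of `Frac(A/𝔭)`, a finite `A/𝔭`-subalgebra `R' ⊆ l` with `Frac R' = l`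
(`exists_finite_subalgebra_isFractionRing`) is a domain finite over the complete regular local
subring `A₀ ⊆ A/𝔭` of Cohen's structure theorem (Matsumura Thm. 29.4 (iii),
`Matsumura1987_29_4_iii_holds`), hence J-0 by the proof of 07PI
(`exists_ne_zero_forall_isRegularLocalRing_of_finite_regular`). [cite: StacksProject, Tag 07PJ] -/
theorem isJ2Ring_of_isAdicComplete (A : Type u) [CommRing A] [IsLocalRing A] [IsNoetherianRing A]
    [IsAdicComplete (maximalIdeal A) A] : IsJ2Ring A := by
  refine isJ2Ring_of_forall_exists_finite A fun p _ l _ _ _ _ _ => ?_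
  -- `A/𝔭` is a complete Noetherian local domain
  haveI hpprime : p.IsPrime := ‹_›
  haveI : Nontrivial (A ⧸ p) := Ideal.Quotient.nontrivial_iff.mpr hpprime.ne_top
  haveI : IsLocalRing (A ⧸ p) :=
    IsLocalRing.of_surjective' (Ideal.Quotient.mk p) Ideal.Quotient.mk_surjective
  haveI : IsDomain (A ⧸ p) := Ideal.Quotient.isDomain p
  haveI : IsAdicComplete (maximalIdeal (A ⧸ p)) (A ⧸ p) := isAdicComplete_quotient p
  -- a finite subalgebra `R' ⊆ l` with `Frac R' = l`
  obtain ⟨R', hR'fin, hR'frac, -⟩ :=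
    exists_finite_subalgebra_isFractionRing (A ⧸ p) (FractionRing (A ⧸ p)) l (0 : l)
  refine ⟨R', hR'fin, hR'frac, ?_⟩
  haveI := hR'fin
  -- Cohen: `A/𝔭` is finite over a complete regular local subring `A₀`
  obtain ⟨A₀, hreg, hcomp, hfin⟩ := Matsumura1987_29_4_iii_holds (A ⧸ p)
  haveI := hreg
  haveI := hcomp
  haveI := hfin
  letI : Algebra A₀ R' := ((algebraMap (A ⧸ p) R').comp (algebraMap A₀ (A ⧸ p))).toAlgebra
  haveI : IsScalarTower A₀ (A ⧸ p) R' := IsScalarTower.of_algebraMap_eq fun _ => rfl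
  haveI : Module.Finite A₀ R' := Module.Finite.trans (A ⧸ p) R'
  have hinjl : Function.Injective (algebraMap (A ⧸ p) l) := by
    rw [IsScalarTower.algebraMap_eq (A ⧸ p) (FractionRing (A ⧸ p)) l]
    exact (algebraMap (FractionRing (A ⧸ p)) l).injective.comp
      (IsFractionRing.injective (A ⧸ p) (FractionRing (A ⧸ p)))
  haveI : FaithfulSMul A₀ R' := by
    rw [faithfulSMul_iff_algebraMap_injective]
    intro a b h
    have h1 : algebraMap (A ⧸ p) R' (a : A ⧸ p) = algebraMap (A ⧸ p) R' (b : A ⧸ p) := h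
    have h2 : algebraMap (A ⧸ p) l (a : A ⧸ p) = algebraMap (A ⧸ p) l (b : A ⧸ p) :=
      congrArg Subtype.val h1
    exact Subtype.ext (hinjl h2)
  exact exists_ne_zero_forall_isRegularLocalRing_of_finite_regular (R := A₀) (A := R')

/-- **DISCHARGE of the named fact `Stacks07QW_complete`** (`ExcellentRings.lean`; The Stacks
Project, Tag 07QW (2): "The following types of rings are excellent: … (2) Noetherian complete
local rings"; Matsumura, *Commutative Ring Theory*, §32 p. 260: "A complete Noetherian local ring
is excellent"; EGA IV₂ 7.8.3 (iii)). The printed proof of 07QW — "See Propositions 07PX and 07PJ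
to see that these rings are G-rings and have J-2 … Via the Cohen structure theorem we see that
complete local rings are universally catenary, see Algebra, Remark 032C" — is now entirely in
the tree: `isUniversallyCatenaryRing_of_isAdicComplete` (Stacks 032C, `ExcellentRingsCompleteUC.lean`),
`Matsumura1987_32_3_holds` (Stacks 07PX / Matsumura Thm. 32.3, `ExcellentRingsCompleteProofs.lean`)
and `isJ2Ring_of_isAdicComplete` (Stacks 07PJ (2), above). [cite: StacksProject, Tag 07QW] -/
theorem Stacks07QW_complete_holds : Stacks07QW_complete.{u} := fun A _ _ _ _ =>
  ⟨isUniversallyCatenaryRing_of_isAdicComplete A, Matsumura1987_32_3_holds A,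
    isJ2Ring_of_isAdicComplete A⟩

/-- Applied form: every complete Noetherian local ring is excellent. [cite: StacksProject, Tag 07QW] -/
theorem isExcellentRing_of_isAdicComplete (A : Type u) [CommRing A] [IsLocalRing A]
    [IsNoetherianRing A] [IsAdicComplete (maximalIdeal A) A] : IsExcellentRing A :=
  Stacks07QW_complete_holds A

end CompleteJ2

end Literature.AlgebraicGeometry.Resolution
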